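import Literature.AlgebraicGeometry.Resolution.HironakaGroupSchemePerfect
import Literature.RingTheory.HilbertSamuel.DirectrixLocal
import Literature.RingTheory.KrullDimension.AffineDimension
import Mathlib.RingTheory.MvPolynomial.Ideal
import Mathlib.FieldTheory.IsAlgClosed.AlgebraicClosure
import HarnessLib

/-!
# [OURS · L1 W4.2] 2.14♯ — algebraic core, part 1 (base change, linear quotients, SHARPENING 1)

Cell res-hironaka, rung L, slot W4.2 (crux `SigmaMaxModificationsCorridor3`, stmt-ResolutionOfSingularities-19249),
typing item T7 = the OURS theorem 2.14♯ `directrix_nearPoint_of_geomDirDim_le` (res-L1-w42-plan-1 RULING v3.8-D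
(D-1); file `…Corridor3Directrix214Sharp.lean`). This helper file is FACT-FREE commutative algebra over
`S = k[X_0, …, X_n]` (`char k = p`) used by the core (`…Corridor3Directrix214SharpCore.lean`):

* `comap_map_eq_self` — `J · K[X] ∩ k[X] = J` for a field extension `K ⊇ k` (via a `k`-linear retraction
  `K → k` extended coefficientwise: `coeffRetract`);
* `ringKrullDim_quotient_map_eq` — `dim k[X]/J = dim K[X]/J·K[X]` for `K/k` algebraic (integral + injective,
  tree `Literature.RingTheory.KrullDimension.ringKrullDim_eq_of_isIntegral`);
* `ringKrullDim_quotient_span_le_sub_finrank` — `dim K[X]/(T) ≤ n + 1 − dim_K T` for a space `T` of linear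
  forms (change of coordinates `coordChangeEquiv`, then `K[X_i : i ∉ J₁] ↠ K[X]/(X_j : j ∈ J₁)`);
* `addForm_eq_rootForm_pow` — over a PERFECT field an additive form `Σ c_j X_j^{p^e}` is the `p^e`-th power of
  the linear form `rootForm` (tree `HironakaScheme.exists_eq_frobVec_of_perfect` / `addForm_frobVec`, file
  `HironakaGroupSchemePerfect.lean`, BY NAME);
* **`ringKrullDim_quotient_span_addForm_le_directrixDim` (SHARPENING 1)** — for a family `G` of additive forms
  and an ideal `I` generated inside `k[G]`: `dim S/(G) ≤ e(I · K[X])` for `K ⊇ k` perfect algebraic: the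
  dimension of the additive group `B = V(G)` is at most the (geometric) directrix dimension of the cone `V(I)`.

[OURS · L1 W4.2]; NOT a statement of any source nor of H. Hironaka's 2017 manuscript. AI-written
(res-type-001); AI review is weaker than expert review.
-/

set_option linter.dupNamespace false

noncomputable section

open MvPolynomial Module
open Literature.RingTheory.MvPolynomial
open Literature.AlgebraicGeometry.Resolution.HironakaScheme

namespace Summit.ResolutionOfSingularities.ResolutionOfSingularities.Theorems.SigmaMaxModificationsCorridor3.Directrix214Sharp

universe u v

/-! ## Extension of the base field: `J · K[X] ∩ k[X] = J` and `dim k[X]/J = dim K[X]/J·K[X]` -/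

section FieldExtension

variable {k : Type u} {K : Type v} [Field k] [Field K] [Algebra k K] {m : ℕ}

/-- A `k`-linear retraction of the structure map `k → K` of a field extension. [folklore] -/
theorem exists_retraction : ∃ r : K →ₗ[k] k, ∀ c : k, r (algebraMap k K c) = c := by
  obtain ⟨g, hg⟩ := LinearMap.exists_leftInverse_of_injective (Algebra.linearMap k K)
    (LinearMap.ker_eq_bot.mpr (algebraMap k K).injective)
  exact ⟨g, fun c => by simpa using LinearMap.congr_fun hg c⟩

/-- The coefficientwise extension `R` of a `k`-linear retraction `r : K → k` to polynomials. [folklore] -/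
def coeffRetract (r : K →ₗ[k] k) (g : MvPolynomial (Fin m) K) : MvPolynomial (Fin m) k :=
  AddMonoidAlgebra.map r.toAddMonoidHom g

/-- Coefficients of the coefficientwise retraction. [folklore] -/
@[simp] theorem coeff_coeffRetract (r : K →ₗ[k] k) (g : MvPolynomial (Fin m) K)
    (n : Fin m →₀ ℕ) : coeff n (coeffRetract r g) = r (coeff n g) :=
  coeff_addMonoidAlgebraMap r.toAddMonoidHom g n

/-- `R` is additive. [folklore] -/
theorem coeffRetract_add (r : K →ₗ[k] k) (g h : MvPolynomial (Fin m) K) :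
    coeffRetract r (g + h) = coeffRetract r g + coeffRetract r h := by
  ext n; simp

/-- `R (f ⊗ 1) = f` for `f ∈ k[X]` when `r` is a retraction. [folklore] -/
theorem coeffRetract_map (r : K →ₗ[k] k) (hr : ∀ c : k, r (algebraMap k K c) = c)
    (f : MvPolynomial (Fin m) k) :
    coeffRetract r (MvPolynomial.map (algebraMap k K) f) = f := by
  ext n; simp [coeff_map, hr]

/-- `R` is `k[X]`-linear: `R ((f ⊗ 1) · g) = f · R g`. [folklore] -/
theorem coeffRetract_map_mul (r : K →ₗ[k] k) (f : MvPolynomial (Fin m) k) (g : MvPolynomial (Fin m) K) :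
    coeffRetract r (MvPolynomial.map (algebraMap k K) f * g) = f * coeffRetract r g := by
  ext n
  rw [coeff_coeffRetract, coeff_mul, coeff_mul, map_sum]
  refine Finset.sum_congr rfl fun x _ => ?_
  rw [coeff_map, coeff_coeffRetract, ← Algebra.smul_def, LinearMap.map_smul, smul_eq_mul]

/-- **`J · K[X] ∩ k[X] = J`**: the extension of an ideal of `k[X]` to `K[X]` (`K ⊇ k` a field
extension) contracts back to the ideal (faithful flatness of `K[X]` over `k[X]`, proved here with a
`k`-linear retraction `K → k`). [folklore] -/
theorem comap_map_eq_self (J : Ideal (MvPolynomial (Fin m) k)) :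
    (J.map (MvPolynomial.map (algebraMap k K))).comap (MvPolynomial.map (algebraMap k K)) = J := by
  obtain ⟨r, hr⟩ := exists_retraction (k := k) (K := K)
  refine le_antisymm ?_ Ideal.le_comap_map
  intro f hf
  rw [Ideal.mem_comap] at hf
  -- every element `x` of `J · K[X]` satisfies `R (h · x) ∈ J` for all `h ∈ K[X]`
  have key : ∀ x ∈ J.map (MvPolynomial.map (algebraMap k K)),
      ∀ h : MvPolynomial (Fin m) K, coeffRetract r (h * x) ∈ J := by
    intro x hx
    rw [Ideal.map, ← Ideal.submodule_span_eq] at hx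
    induction hx using Submodule.span_induction with
    | mem x hx =>
      obtain ⟨j, hj, rfl⟩ := hx
      intro h
      rw [mul_comm, coeffRetract_map_mul]
      exact Ideal.mul_mem_right _ _ hj
    | zero => intro h; rw [mul_zero]; convert J.zero_mem using 1; ext n; simp [coeff_coeffRetract]
    | add x y _ _ hx hy => intro h; rw [mul_add, coeffRetract_add]; exact J.add_mem (hx h) (hy h)
    | smul a x _ hx => intro h; rw [smul_eq_mul, ← mul_assoc]; exact hx (h * a)
  have := key _ hf 1
  rwa [one_mul, coeffRetract_map r hr] at this

/-- **`dim k[X]/J = dim K[X]/(J · K[X])` for an algebraic field extension `K/k`** (integral, and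
injective on the quotients by `comap_map_eq_self`). [cite: Matsumura1987, Thm 9.4] -/
theorem ringKrullDim_quotient_map_eq [Algebra.IsIntegral k K] (J : Ideal (MvPolynomial (Fin m) k)) :
    ringKrullDim (MvPolynomial (Fin m) K ⧸ J.map (MvPolynomial.map (algebraMap k K))) =
      ringKrullDim (MvPolynomial (Fin m) k ⧸ J) := by
  letI := MvPolynomial.algebraMvPolynomial (σ := Fin m) (R := k) (S := K)
  set JK : Ideal (MvPolynomial (Fin m) K) :=
    J.map (algebraMap (MvPolynomial (Fin m) k) (MvPolynomial (Fin m) K)) with hJK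
  have hJK' : J.map (MvPolynomial.map (algebraMap k K)) = JK := by
    rw [hJK, MvPolynomial.algebraMap_def]
  rw [hJK']
  have h1 : ringKrullDim (MvPolynomial (Fin m) k ⧸ JK.comap (algebraMap _ _)) =
      ringKrullDim (MvPolynomial (Fin m) K ⧸ JK) :=
    Literature.RingTheory.KrullDimension.ringKrullDim_eq_of_isIntegral
      Ideal.algebraMap_quotient_injective
  have h2 : JK.comap (algebraMap _ _) = J := by
    rw [hJK, MvPolynomial.algebraMap_def]
    exact comap_map_eq_self J
  rw [← h1]
  exact ringKrullDim_eq_of_ringEquiv (Ideal.quotEquivOfEq h2)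

end FieldExtension

/-! ## `dim K[X]/(T) ≤ n − dim T` for a space `T` of linear forms -/

section LinearQuotient

variable {K : Type u} [Field K] {m : ℕ}

/-- The ideal generated by a `K`-subspace is the ideal generated by any spanning set. [folklore] -/
theorem ideal_span_submodule_span (s : Set (MvPolynomial (Fin m) K)) :
    Ideal.span (Submodule.span K s : Set (MvPolynomial (Fin m) K)) = Ideal.span s := by
  refine le_antisymm ?_ (Ideal.span_mono Submodule.subset_span)
  rw [Ideal.span_le]
  intro f hf
  induction hf using Submodule.span_induction with
  | mem x hx => exact Ideal.subset_span hx
  | zero => exact Ideal.zero_mem _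
  | add x y _ _ hx hy => exact Ideal.add_mem _ hx hy
  | smul c x _ hx =>
    rw [SetLike.mem_coe, MvPolynomial.smul_eq_C_mul]
    exact Ideal.mul_mem_left _ _ hx

/-- `K[X_i : i ∉ J₁] → K[X]/(X_j : j ∈ J₁)` is surjective. [folklore] -/
theorem quotient_span_X_mk_rename_surjective (J₁ : Finset (Fin m)) :
    Function.Surjective ((Ideal.Quotient.mk (Ideal.span (MvPolynomial.X '' (J₁ : Set (Fin m)) :
        Set (MvPolynomial (Fin m) K)))).comp
      (MvPolynomial.rename ((↑) : {i : Fin m // i ∉ J₁} → Fin m)).toRingHom) := by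
  classical
  set L : Ideal (MvPolynomial (Fin m) K) := Ideal.span (MvPolynomial.X '' (J₁ : Set (Fin m))) with hL
  -- the substitution killing the variables of `J₁`
  let h : Fin m → MvPolynomial {i : Fin m // i ∉ J₁} K := fun i =>
    if hi : i ∈ J₁ then 0 else MvPolynomial.X ⟨i, hi⟩
  have hcomp : (Ideal.Quotient.mkₐ K L).comp ((MvPolynomial.rename
      ((↑) : {i : Fin m // i ∉ J₁} → Fin m)).comp (MvPolynomial.aeval h)) = Ideal.Quotient.mkₐ K L := by
    refine MvPolynomial.algHom_ext fun i => ?_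
    rw [AlgHom.comp_apply, AlgHom.comp_apply, MvPolynomial.aeval_X]
    by_cases hi : i ∈ J₁
    · simp only [h, dif_pos hi, map_zero]
      rw [Ideal.Quotient.mkₐ_eq_mk, eq_comm, Ideal.Quotient.eq_zero_iff_mem]
      exact Ideal.subset_span ⟨i, hi, rfl⟩
    · simp only [h, dif_neg hi, MvPolynomial.rename_X]
  intro y
  obtain ⟨f, rfl⟩ := Ideal.Quotient.mk_surjective y
  refine ⟨MvPolynomial.aeval h f, ?_⟩
  have := congrArg (fun φ : MvPolynomial (Fin m) K →ₐ[K] MvPolynomial (Fin m) K ⧸ L => φ f) hcomp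
  simp only [AlgHom.comp_apply, Ideal.Quotient.mkₐ_eq_mk] at this
  exact this

/-- `dim K[X]/(X_j : j ∈ J₁) ≤ n − |J₁|`. [folklore] -/
theorem ringKrullDim_quotient_span_X_le (J₁ : Finset (Fin m)) :
    ringKrullDim (MvPolynomial (Fin m) K ⧸ Ideal.span (MvPolynomial.X '' (J₁ : Set (Fin m)) :
      Set (MvPolynomial (Fin m) K))) ≤ ((m - J₁.card : ℕ) : WithBot ℕ∞) := by
  classical
  refine (ringKrullDim_le_of_surjective _ (quotient_span_X_mk_rename_surjective J₁)).trans ?_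
  rw [MvPolynomial.ringKrullDim_of_isNoetherianRing, ringKrullDim_eq_zero_of_field, zero_add,
    Nat.card_eq_fintype_card, Fintype.card_subtype_compl, Fintype.card_fin, Fintype.card_coe]

/-- **`dim K[X]/(T) ≤ n − dim_K T`** for a subspace `T ⊆ S_1` of linear forms (in fact equality:
`K[X]/(T) ≅ K[X]/(X_1, …, X_r)` after a linear change of coordinates, `r = dim T`). [folklore] -/
theorem ringKrullDim_quotient_span_le_sub_finrank (T : Submodule K (MvPolynomial (Fin m) K))
    (hT : T ≤ homogeneousSubmodule (Fin m) K 1) :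
    ringKrullDim (MvPolynomial (Fin m) K ⧸ Ideal.span (T : Set (MvPolynomial (Fin m) K))) ≤
      ((m - Module.finrank K T : ℕ) : WithBot ℕ∞) := by
  classical
  -- a basis `b` of `Kⁿ` with `T = span {linForm (b j) : j ∈ J₁}`
  obtain ⟨b, J₁, -, hJ₁, -⟩ := exists_basis_adapted (T.comap linForm) (⊤ : Submodule K (Fin m → K))
  have hT' : T = Submodule.span K ((fun j => linForm (K := K) (b j)) '' (J₁ : Set (Fin m))) := by
    rw [← map_comap_linForm hT, ← hJ₁, Submodule.map_span, Set.image_image]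
  -- `finrank T ≤ |J₁|`
  have hfin : Module.finrank K T ≤ J₁.card := by
    rw [hT', Set.image_eq_range]
    exact (finrank_range_le_card _).trans (le_of_eq (by simp))
  -- change coordinates: `θ (linForm (b j)) = X_j`
  set θ := coordChangeEquiv b with hθ
  have hmap : (Ideal.span (T : Set (MvPolynomial (Fin m) K))).map (θ : MvPolynomial (Fin m) K →+*
      MvPolynomial (Fin m) K) = Ideal.span (MvPolynomial.X '' (J₁ : Set (Fin m))) := by
    rw [hT', ideal_span_submodule_span, Ideal.map_span, Set.image_image]
    congr 1
    refine Set.image_congr' fun j => ?_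
    exact coordChangeEquiv_linForm_basis b j
  rw [ringKrullDim_eq_of_ringEquiv (Ideal.quotientEquiv _ _ (θ : MvPolynomial (Fin m) K ≃+*
    MvPolynomial (Fin m) K) hmap.symm)]
  refine (ringKrullDim_quotient_span_X_le J₁).trans ?_
  exact_mod_cast Nat.sub_le_sub_left hfin m

end LinearQuotient

/-! ## Additive forms over a perfect extension: roots, and SHARPENING 1 -/

section Additive

variable {k : Type u} [Field k] (p : ℕ) [Fact p.Prime] [CharP k p] {n : ℕ}
variable {K : Type v} [Field K] [Algebra k K] [CharP K p]

/-- The additive form `Σ_j a_j X_j^{p^e}` attached to a level `e` and a coefficient vector `a`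
(tree `HironakaScheme.addForm`), as a function of the pair. [folklore] -/
abbrev addFormOf (ea : ℕ × (Fin (n + 1) → k)) : MvPolynomial (Fin (n + 1)) k :=
  addForm k p ea.1 ea.2

omit [Fact p.Prime] [CharP k p] [CharP K p] in
/-- Base change of an additive form: `(Σ a_j X_j^{p^e}) ⊗ 1 = Σ ι(a_j) X_j^{p^e}`. [folklore] -/
theorem map_addForm (e : ℕ) (a : Fin (n + 1) → k) :
    MvPolynomial.map (algebraMap k K) (addForm k p e a) = addForm K p e (algebraMap k K ∘ a) := by
  simp only [addForm, map_sum, map_mul, map_pow, map_C, map_X, Function.comp_apply]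

omit [Fact p.Prime] [CharP K p] [Algebra k K] in
/-- In level `0` the additive form is the linear form `Σ b_j X_j`. [folklore] -/
theorem addForm_zero_eq_linForm (b : Fin (n + 1) → K) : addForm K p 0 b = linForm b := by
  simp only [addForm, pow_zero, pow_one, linForm_apply, MvPolynomial.smul_eq_C_mul]

omit [Fact p.Prime] [CharP K p] [Algebra k K] in
/-- Level-`0` additive forms are forms of degree `1`. [folklore] -/
theorem addForm_zero_mem_one (b : Fin (n + 1) → K) :
    addForm K p 0 b ∈ homogeneousSubmodule (Fin (n + 1)) K 1 := by
  rw [addForm_zero_eq_linForm]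
  exact isHomogeneous_linForm b

variable [PerfectRing K p]

/-- Over a PERFECT field of characteristic `p` every coefficient vector `c` is `F^e b` for a (unique)
`b`; this is that `b` (tree `exists_eq_frobVec_of_perfect`). [folklore] -/
def rootVec (e : ℕ) (c : Fin (n + 1) → K) : Fin (n + 1) → K :=
  Classical.choose (exists_eq_frobVec_of_perfect (k := K) (p := p) e c)

omit [Algebra k K] in
/-- `F^e (rootVec e c) = c`. [folklore] -/
theorem frobVec_rootVec (e : ℕ) (c : Fin (n + 1) → K) : frobVec K p e (rootVec p e c) = c :=
  Classical.choose_spec (exists_eq_frobVec_of_perfect (k := K) (p := p) e c)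

/-- The linear form `ℓ = Σ c_j^{1/p^e} X_j` with `ℓ^{p^e} = Σ c_j X_j^{p^e}` over a perfect field. [folklore] -/
def rootForm (e : ℕ) (c : Fin (n + 1) → K) : MvPolynomial (Fin (n + 1)) K :=
  addForm K p 0 (rootVec p e c)

omit [Algebra k K] in
/-- **Over a perfect field an additive form is a `p^e`-th power of a linear form**:
`Σ c_j X_j^{p^e} = (rootForm e c)^{p^e}` (tree `addForm_frobVec`). [folklore] -/
theorem addForm_eq_rootForm_pow (e : ℕ) (c : Fin (n + 1) → K) :
    addForm K p e c = rootForm p e c ^ p ^ e := by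
  rw [rootForm, ← addForm_frobVec, frobVec_rootVec]

omit [Algebra k K] in
/-- `rootForm e c` is a form of degree `1`. [folklore] -/
theorem rootForm_mem_one (e : ℕ) (c : Fin (n + 1) → K) :
    rootForm p e c ∈ homogeneousSubmodule (Fin (n + 1)) K 1 :=
  addForm_zero_mem_one p _

omit [CharP k p] in
/-- **SHARPENING 1.** Let `G = {Σ a_j X_j^{p^e}}` be a family of additive forms in `S = k[X_0, …, X_n]`
(`char k = p`), `J = (G) · S` the ideal of the homogeneous additive group `B = V(G)`, and `I ⊆ S` an ideal
GENERATED by elements of the algebra `k[G]`. Then for every perfect algebraic extension `K ⊇ k`,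
`dim S/J ≤ e(I · K[X])` — the dimension of `B` is at most the dimension of the directrix of the cone of
`I` over `K`. (Over `K` each generator is `ℓ^{p^e}` with `ℓ` linear; `I · K[X]` is generated inside
`K[ℓ's]`, so its directrix space lies in the span `T` of the `ℓ`'s, while `V(G)_K` is set-theoretically
the linear space `V(T)` of dimension `n + 1 − dim T`.) [OURS · L1 W4.2, the «SHARPENING 1» of crux-chain
w42 RULING v3.8-D; AI-written, weaker than expert review] -/
theorem ringKrullDim_quotient_span_addForm_le_directrixDim [Algebra.IsIntegral k K]
    (A : Set (ℕ × (Fin (n + 1) → k))) (I : Ideal (MvPolynomial (Fin (n + 1)) k))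
    (hI : I ≤ Ideal.span ((I : Set (MvPolynomial (Fin (n + 1)) k)) ∩
      (Algebra.adjoin k (addFormOf p '' A) : Set (MvPolynomial (Fin (n + 1)) k)))) :
    ringKrullDim (MvPolynomial (Fin (n + 1)) k ⧸ Ideal.span (addFormOf p '' A)) ≤
      (directrixDim (I.map (MvPolynomial.map (algebraMap k K))) : WithBot ℕ∞) := by
  classical
  set ι : k →+* K := algebraMap k K with hι
  set G : Set (MvPolynomial (Fin (n + 1)) k) := addFormOf p '' A with hG
  set J : Ideal (MvPolynomial (Fin (n + 1)) k) := Ideal.span G with hJ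
  -- the roots over `K`
  set R : Set (MvPolynomial (Fin (n + 1)) K) :=
    (fun ea : ℕ × (Fin (n + 1) → k) => rootForm p ea.1 (ι ∘ ea.2)) '' A with hR
  set T : Submodule K (MvPolynomial (Fin (n + 1)) K) := Submodule.span K R with hT
  have hT1 : T ≤ homogeneousSubmodule (Fin (n + 1)) K 1 := by
    rw [hT, Submodule.span_le]
    rintro _ ⟨ea, -, rfl⟩
    exact rootForm_mem_one p _ _
  haveI : FiniteDimensional K T := Submodule.finiteDimensional_of_le hT1
  -- images of the generators are powers of the roots
  have hmapG : ∀ ea : ℕ × (Fin (n + 1) → k),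
      MvPolynomial.map ι (addFormOf p ea) = rootForm p ea.1 (ι ∘ ea.2) ^ p ^ ea.1 := by
    intro ea
    rw [addFormOf, map_addForm, addForm_eq_rootForm_pow]
  -- (1) `dim S/J = dim S_K / J·S_K`
  have h1 := ringKrullDim_quotient_map_eq (k := k) (K := K) J
  -- (2) `J · S_K` and `(R)` have the same zero locus
  have hzero : PrimeSpectrum.zeroLocus ((J.map (MvPolynomial.map ι) : Ideal _) : Set (MvPolynomial (Fin (n + 1)) K))
      = PrimeSpectrum.zeroLocus ((Ideal.span R : Ideal _) : Set (MvPolynomial (Fin (n + 1)) K)) := by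
    rw [hJ, Ideal.map_span, PrimeSpectrum.zeroLocus_span, PrimeSpectrum.zeroLocus_span]
    ext P
    simp only [PrimeSpectrum.mem_zeroLocus, Set.image_subset_iff]
    constructor
    · intro h
      rintro _ ⟨ea, hea, rfl⟩
      have hmem : MvPolynomial.map ι (addFormOf p ea) ∈ P.asIdeal := h ⟨ea, hea, rfl⟩
      rw [hmapG] at hmem
      exact P.isPrime.mem_of_pow_mem _ hmem
    · intro h
      rintro _ ⟨ea, hea, rfl⟩
      change MvPolynomial.map ι (addFormOf p ea) ∈ P.asIdeal
      rw [hmapG]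
      exact Ideal.pow_mem_of_mem _ (h ⟨ea, hea, rfl⟩) _ (pow_pos (Fact.out : p.Prime).pos _)
  have h2 : ringKrullDim (MvPolynomial (Fin (n + 1)) K ⧸ J.map (MvPolynomial.map ι)) =
      ringKrullDim (MvPolynomial (Fin (n + 1)) K ⧸ Ideal.span R) := by
    rw [ringKrullDim_quotient, ringKrullDim_quotient, hzero]
  -- (3) `dim S_K/(R) ≤ n + 1 − dim T`
  have h3 : ringKrullDim (MvPolynomial (Fin (n + 1)) K ⧸ Ideal.span R) ≤
      ((n + 1 - Module.finrank K T : ℕ) : WithBot ℕ∞) := by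
    rw [← ideal_span_submodule_span R]
    exact ringKrullDim_quotient_span_le_sub_finrank T hT1
  -- (4) `T` directs `I · S_K`
  have h4 : Directs (I.map (MvPolynomial.map ι)) T := by
    refine ⟨hT1, Ideal.map_le_iff_le_comap.mpr fun f hf => ?_⟩
    rw [Ideal.mem_comap]
    have hf' : MvPolynomial.map ι f ∈ (Ideal.span ((I : Set (MvPolynomial (Fin (n + 1)) k)) ∩
        (Algebra.adjoin k G : Set (MvPolynomial (Fin (n + 1)) k)))).map (MvPolynomial.map ι) :=
      Ideal.mem_map_of_mem _ (hI hf)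
    rw [Ideal.map_span] at hf'
    refine Ideal.span_mono (fun x hx => ?_) hf'
    obtain ⟨g, ⟨hgI, hgG⟩, rfl⟩ := hx
    refine Set.mem_inter (Ideal.mem_map_of_mem _ hgI) ?_
    have hsub : MvPolynomial.map ι '' G ⊆ (Algebra.adjoin K (T : Set (MvPolynomial (Fin (n + 1)) K)) :
        Set (MvPolynomial (Fin (n + 1)) K)) := by
      rintro _ ⟨_, ⟨ea, hea, rfl⟩, rfl⟩
      rw [hmapG]
      have hroot : rootForm p ea.1 (ι ∘ ea.2) ∈ (T : Set (MvPolynomial (Fin (n + 1)) K)) := by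
        rw [hT]
        exact Submodule.subset_span ⟨ea, hea, rfl⟩
      exact pow_mem (Algebra.subset_adjoin hroot) _
    exact Algebra.adjoin_le hsub (map_mem_adjoin_image ι hgG)
  -- (5) dimension count
  have h5 : Module.finrank K (directrixSpace (I.map (MvPolynomial.map ι))) ≤ Module.finrank K T :=
    Submodule.finrank_mono (directrixSpace_le h4)
  have h6 := finrank_directrixSpace_add_directrixDim (I.map (MvPolynomial.map ι))
  rw [← h1, h2]
  refine h3.trans ?_
  exact_mod_cast (by omega : n + 1 - Module.finrank K T ≤ directrixDim (I.map (MvPolynomial.map ι)))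

end Additive

end Summit.ResolutionOfSingularities.ResolutionOfSingularities.Theorems.SigmaMaxModificationsCorridor3.Directrix214Sharp

end
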